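import Summits.MatrixMultiplication.MatrixMultiplication.Theorems.LevelGradedCohnUmansLevelOneGL2DesignsGaussianUnitalResidueCap

/-!
# Residue rules for the Gaussian unital lift, II: a clean class has a certificate (Dirichlet), hence
`|D|² ≤ m` for every residue rule — stub `stub_tangencySets` (crux `LevelOneGL2Designs`,
stmt-MatrixMultiplication-14080), wall-breaker axis 10/12 "Hermitian unital constructions",
generation 1 (seat 3), cycle 2, part 7

Part 6 (`…GaussianUnitalResidueCap`) showed that certificates `q^k ∥ e` (`q ≡ 3 (mod 4)` prime,
`k` odd, `q^(k+1) ∣ m`) clear a residue class `e + mℤ` of `±(sums of two squares)` and that digit sets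
with pairwise certificates have `|D|² ≤ m`.  Here:

* `exists_sq_add_sq_of_no_certificate` — the converse: if `e` has NO such certificate then some
  `n ≡ e (mod m)` has `|n| = x² + y²`.  Proof: with `g = gcd(e,m)`, `e = g·e₁`, `m = g·m₁`, let `P` be
  the product of the primes `q ≡ 3 (mod 4)` with `v_q(g)` odd; the missing certificates say exactly
  that no such `q` divides `m₁`, so by DIRICHLET (Mathlib, `Nat.forall_exists_prime_gt_and_zmodEq`)
  there is a prime `ρ ≡ 1 (mod 4)` with `P·ρ ≡ ±e₁ (mod m₁)` (the sign absorbs the obstruction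
  `e₁ ≡ 3 (mod 4)` when `4 ∣ m₁`), and `n = ±g·P·ρ` works (Fermat–Euler);
* `residueRule_iff_certificate` — so "the class `e + mℤ` is free of `±(a²+b²)`" is EQUIVALENT to the
  existence of a certificate below the precision of `m`;
* `card_sq_le_of_residueRule` — **every residue rule for the Gaussian unital lift has `|D|² ≤ m`**:
  if `D ⊆ ℤ` is finite and for all `d ≠ d'` in `D` no `n ≡ d − d' (mod m)` has `|n|` a sum of two
  squares, then `|D|² ≤ m` (sharp for `m = q²`, `q ≡ 3 (mod 4)`: part 6, `residueRule_multiples`).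

Consequence for the axis (AXIS.md R8′): digit sets for the Gaussian door of the LIFTED unital built
from residue rules — the format of every construction on record (base `9`, digits `{0,3,6}`; seat
7-3's exhaustive search mod `9·49`, maximum `21 = √441`, is the case `m = 441` of this theorem) — have
exponent `≤ 1/2` in every base, so this door yields at most `p^{5/4}` by local means; `γ₂ > 1/2`
(sets `U ⊆ [0,M)` with no two elements differing by a sum of two squares, `|U| = M^{γ₂+o(1)}`) needs a
non-local idea, and from above only `|U| ≤ M·exp(−c√log M)` is known (Rice 2019, Thm 1.1).
Elementary given Dirichlet's theorem; no definitions.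
-/

-- `Summit.MatrixMultiplication.MatrixMultiplication.…` is the tree's mandated summit/problem namespace (D-0017).
set_option linter.dupNamespace false

namespace Summit.MatrixMultiplication.MatrixMultiplication.Theorems.LevelOneGL2Designs.GaussianUnital

open Finset

/-- **Sign-and-shift to `1 (mod 4)`.**  If `m` is odd or `u` is odd, then `σ·u + t·m ≡ 1 (mod 4)` for
some sign `σ = ±1` and some shift `t` (a finite check on residues mod `4`). [elementary] -/
theorem exists_sign_shift_one_mod_four (u m : ℤ) (h : m % 2 = 1 ∨ u % 2 = 1) :
    ∃ σ t : ℤ, (σ = 1 ∨ σ = -1) ∧ (σ * u + t * m) % 4 = 1 := by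
  have hm : m % 4 = 0 ∨ m % 4 = 1 ∨ m % 4 = 2 ∨ m % 4 = 3 := by omega
  have hu : u % 4 = 0 ∨ u % 4 = 1 ∨ u % 4 = 2 ∨ u % 4 = 3 := by omega
  rcases hm with hm | hm | hm | hm <;> rcases hu with hu | hu | hu | hu <;>
    first
    | exact absurd h (by omega)
    | exact ⟨1, 0, Or.inl rfl, by omega⟩
    | exact ⟨1, 1, Or.inl rfl, by omega⟩
    | exact ⟨1, 2, Or.inl rfl, by omega⟩
    | exact ⟨1, 3, Or.inl rfl, by omega⟩
    | exact ⟨-1, 0, Or.inr rfl, by omega⟩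

/-- **A class without certificate meets the sums of two squares (Dirichlet).**  Let `m ≥ 1` and
`e ∈ ℤ`.  If for every prime `q ≡ 3 (mod 4)` and every odd `k` with `q^(k+1) ∣ m` we have
`q^k ∣ e → q^(k+1) ∣ e` (no certificate `q^k ∥ e` below the precision of `m`), then some `n ≡ e (mod m)`
has `|n|` a sum of two squares.  [Dirichlet's theorem on primes in progressions + Fermat–Euler; the
integer `n = ±g·P·ρ` of the module docstring] -/
theorem exists_sq_add_sq_of_no_certificate (m : ℕ) (hm : 0 < m) (e : ℤ)
    (H : ∀ q k : ℕ, q.Prime → q % 4 = 3 → Odd k → q ^ (k + 1) ∣ m →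
      (q : ℤ) ^ k ∣ e → (q : ℤ) ^ (k + 1) ∣ e) :
    ∃ n : ℤ, (m : ℤ) ∣ n - e ∧ ∃ x y : ℕ, n.natAbs = x ^ 2 + y ^ 2 := by
  classical
  -- pass to `E = |e|`
  set E : ℕ := e.natAbs with hEdef
  have HE : ∀ q k : ℕ, q.Prime → q % 4 = 3 → Odd k → q ^ (k + 1) ∣ m →
      q ^ k ∣ E → q ^ (k + 1) ∣ E := by
    intro q k hq hq3 hk hqm hqE
    have h1 : (q : ℤ) ^ k ∣ e := by exact_mod_cast (Int.natCast_dvd.mpr hqE : ((q ^ k : ℕ) : ℤ) ∣ e)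
    have h2 : ((q ^ (k + 1) : ℕ) : ℤ) ∣ e := by exact_mod_cast H q k hq hq3 hk hqm h1
    exact Int.natCast_dvd.mp h2
  -- `g = gcd(E, m)`, `E = g E₁`, `m = g m₁`, `gcd(E₁, m₁) = 1`
  set g : ℕ := Nat.gcd E m with hgdef
  have hg : 0 < g := Nat.gcd_pos_of_pos_right _ hm
  have hg0 : g ≠ 0 := hg.ne'
  set E₁ : ℕ := E / g with hE₁def
  set m₁ : ℕ := m / g with hm₁def
  have hE1 : E = g * E₁ := (Nat.mul_div_cancel' (Nat.gcd_dvd_left E m)).symm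
  have hm1 : m = g * m₁ := (Nat.mul_div_cancel' (Nat.gcd_dvd_right E m)).symm
  have hcop : Nat.Coprime E₁ m₁ := Nat.coprime_div_gcd_div_gcd hg
  have hm1pos : 0 < m₁ := Nat.pos_of_ne_zero fun h0 => by rw [h0, mul_zero] at hm1; omega
  -- `B` = primes `q ≡ 3 (mod 4)` with `v_q(g)` odd; `P` = their product
  set B : Finset ℕ := g.primeFactors.filter fun q => q % 4 = 3 ∧ Odd (g.factorization q) with hBdef
  set P : ℕ := ∏ q ∈ B, q with hPdef
  have hBprime : ∀ q ∈ B, q.Prime := fun q hq => Nat.prime_of_mem_primeFactors (mem_filter.mp hq).1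
  have hP0 : P ≠ 0 := Finset.prod_ne_zero_iff.mpr fun q hq => (hBprime q hq).ne_zero
  -- the missing certificates: no prime of `B` divides `m₁`
  have hB : ∀ q ∈ B, ¬ q ∣ m₁ := by
    intro q hq hqm1
    have hqp := hBprime q hq
    obtain ⟨-, hq3, hodd⟩ := mem_filter.mp hq
    have hqk : q ^ g.factorization q ∣ g := (hqp.pow_dvd_iff_le_factorization hg0).mpr le_rfl
    have hqm : q ^ (g.factorization q + 1) ∣ m := by
      rw [hm1, pow_succ]; exact mul_dvd_mul hqk hqm1
    have hqE : q ^ g.factorization q ∣ E := hqk.trans (Nat.gcd_dvd_left E m)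
    have hgcd : q ^ (g.factorization q + 1) ∣ g :=
      Nat.dvd_gcd (HE q _ hqp hq3 hodd hqm hqE) hqm
    have := (hqp.pow_dvd_iff_le_factorization hg0).mp hgcd
    omega
  have hPcop : Nat.Coprime P m₁ :=
    Nat.Coprime.prod_left fun q hq => (Nat.Prime.coprime_iff_not_dvd (hBprime q hq)).mpr (hB q hq)
  -- Bezout: `u₀` with `P u₀ ≡ E₁ (mod m₁)`
  obtain ⟨a, b, hab⟩ : IsCoprime (P : ℤ) (m₁ : ℤ) := Nat.isCoprime_iff_coprime.mpr hPcop
  set u₀ : ℤ := a * E₁ with hu₀def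
  have hu0mod : (P : ℤ) * u₀ ≡ E₁ [ZMOD m₁] := by
    rw [Int.modEq_iff_dvd]
    exact ⟨b * E₁, by linear_combination (-(E₁ : ℤ)) * hab⟩
  -- parity: `m₁` odd or `u₀` odd
  have hpar : (m₁ : ℤ) % 2 = 1 ∨ u₀ % 2 = 1 := by
    rcases Nat.even_or_odd m₁ with hev | hodd
    · right
      have h2m : 2 ∣ m₁ := even_iff_two_dvd.mp hev
      have hE1odd : ¬ 2 ∣ E₁ := fun h2 => by
        have h := Nat.dvd_gcd h2 h2m
        rw [hcop] at h
        exact absurd h (by norm_num)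
      by_contra hu
      have hu2 : (2 : ℤ) ∣ u₀ := Int.dvd_of_emod_eq_zero (by omega)
      have h2m' : (2 : ℤ) ∣ (m₁ : ℤ) := by exact_mod_cast h2m
      have h3 : (2 : ℤ) ∣ (E₁ : ℤ) - P * u₀ := (hu0mod.of_dvd h2m').dvd
      have h4 : (2 : ℤ) ∣ (E₁ : ℤ) := by
        have := dvd_add h3 (dvd_mul_of_dvd_right hu2 (P : ℤ))
        simpa using this
      exact hE1odd (by exact_mod_cast h4)
    · left
      exact_mod_cast Nat.odd_iff.mp hodd
  -- sign and shift: `u = σ u₀ + t m₁ ≡ 1 (mod 4)`, `P u ≡ σ E₁ (mod m₁)`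
  obtain ⟨σ, t, hσ, hu4⟩ := exists_sign_shift_one_mod_four u₀ m₁ hpar
  set u : ℤ := σ * u₀ + t * m₁ with hudef
  have humod : (P : ℤ) * u ≡ σ * E₁ [ZMOD m₁] := by
    obtain ⟨c, hc⟩ := Int.ModEq.dvd hu0mod   -- E₁ - P u₀ = m₁ c
    rw [Int.modEq_iff_dvd]
    exact ⟨σ * c - P * t, by rw [hudef]; linear_combination σ * hc⟩
  -- `u` is coprime to `4 m₁`
  have hcu4 : IsCoprime u 4 := by
    have hdiv := Int.emod_add_mul_ediv u 4
    exact ⟨1, -(u / 4), by linear_combination -hdiv + hu4⟩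
  have hcum : IsCoprime u (m₁ : ℤ) := by
    have h1 : IsCoprime (σ * (E₁ : ℤ)) (m₁ : ℤ) := by
      have hE : IsCoprime (E₁ : ℤ) (m₁ : ℤ) := Nat.isCoprime_iff_coprime.mpr hcop
      rcases hσ with rfl | rfl
      · simpa using hE
      · simpa using hE.neg_left
    obtain ⟨c, hc⟩ := Int.ModEq.dvd humod     -- σ E₁ - P u = m₁ c
    have h2 : IsCoprime ((P : ℤ) * u) (m₁ : ℤ) := by
      have : (P : ℤ) * u = σ * E₁ + m₁ * (-c) := by linear_combination -hc
      rw [this]; exact h1.add_mul_left_left (-c)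
    exact h2.of_mul_left_right
  have hcop4m : IsCoprime u ((4 * m₁ : ℕ) : ℤ) := by
    push_cast; exact hcu4.mul_right hcum
  -- DIRICHLET: a prime `ρ ≡ u (mod 4 m₁)`
  obtain ⟨ρ, -, hρ, hρu⟩ := Nat.forall_exists_prime_gt_and_zmodEq 0 (by omega : 4 * m₁ ≠ 0) hcop4m
  have hρu' : (ρ : ℤ) ≡ u [ZMOD 4 * (m₁ : ℤ)] := by exact_mod_cast hρu
  have hρ4 : (ρ : ℤ) % 4 = 1 := by
    have h := hρu'.of_mul_right (m₁ : ℤ)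
    unfold Int.ModEq at h
    omega
  have hρ4' : ρ % 4 = 1 := by
    have h := Int.natCast_mod ρ 4
    omega
  have hρm : (ρ : ℤ) ≡ u [ZMOD m₁] := hρu'.of_mul_left 4
  have hρ0 : ρ ≠ 0 := hρ.ne_zero
  -- `n₀ = g P ρ` is a sum of two squares (Fermat–Euler)
  have hS2 : ∃ x y : ℕ, g * P * ρ = x ^ 2 + y ^ 2 := by
    rw [Nat.eq_sq_add_sq_iff]
    intro q hq hq3
    have hqp : q.Prime := Nat.prime_of_mem_primeFactors hq
    rw [← Nat.factorization_def _ hqp, Nat.factorization_mul (mul_ne_zero hg0 hP0) hρ0,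
      Nat.factorization_mul hg0 hP0]
    simp only [Finsupp.coe_add, Pi.add_apply]
    have hρq : ρ.factorization q = 0 := by
      rw [hρ.factorization, Finsupp.single_apply, if_neg]
      rintro rfl
      omega
    have hPq : P.factorization q = if q ∈ B then 1 else 0 := by
      rw [hPdef, Nat.factorization_prod fun i hi => (hBprime i hi).ne_zero, Finsupp.finsetSum_apply]
      have : ∀ i ∈ B, (i.factorization) q = if i = q then 1 else 0 := fun i hi => by
        rw [(hBprime i hi).factorization, Finsupp.single_apply]
      rw [Finset.sum_congr rfl this, Finset.sum_ite_eq']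
    rw [hρq, hPq, add_zero]
    by_cases hqB : q ∈ B
    · rw [if_pos hqB]
      exact ((mem_filter.mp hqB).2.2).add_one
    · rw [if_neg hqB, add_zero]
      by_contra hne
      apply hqB
      have hodd : Odd (g.factorization q) := Nat.not_even_iff_odd.mp hne
      rw [hBdef, mem_filter, Nat.mem_primeFactors]
      exact ⟨⟨hqp, Nat.dvd_of_factorization_pos hodd.pos.ne', hg0⟩, hq3, hodd⟩
  obtain ⟨x, y, hxy⟩ := hS2
  -- `n₀ ≡ σ E (mod m)`
  have hPρ : (P : ℤ) * ρ ≡ σ * E₁ [ZMOD m₁] := (hρm.mul_left (P : ℤ)).trans humod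
  have hmod : ((g * P * ρ : ℕ) : ℤ) ≡ σ * E [ZMOD m] := by
    have h1 : ((g * P * ρ : ℕ) : ℤ) = (g : ℤ) * ((P : ℤ) * ρ) := by push_cast; ring
    have h2 : (σ : ℤ) * E = g * (σ * E₁) := by rw [hE1]; push_cast; ring
    have h3 : (m : ℤ) = g * m₁ := by exact_mod_cast hm1
    rw [h1, h2, h3]
    exact hPρ.mul_left'
  have hσ2 : σ * σ = 1 := by rcases hσ with rfl | rfl <;> norm_num
  have hkey : (E : ℤ) ≡ σ * (g * P * ρ : ℕ) [ZMOD m] :=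
    calc (E : ℤ) = σ * (σ * E) := by rw [← mul_assoc, hσ2, one_mul]
      _ ≡ σ * (g * P * ρ : ℕ) [ZMOD m] := (hmod.mul_left σ).symm
  have habs : (σ * ((g * P * ρ : ℕ) : ℤ)).natAbs = x ^ 2 + y ^ 2 := by
    rw [Int.natAbs_mul, Int.natAbs_natCast, hxy]
    rcases hσ with rfl | rfl <;> simp
  -- choose the sign according to `e = ±E`
  rcases Int.natAbs_eq e with he | he
  · refine ⟨σ * (g * P * ρ : ℕ), ?_, x, y, habs⟩
    rw [he]
    exact hkey.dvd
  · refine ⟨-(σ * (g * P * ρ : ℕ)), ?_, x, y, by rw [Int.natAbs_neg, habs]⟩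
    rw [he, sub_neg_eq_add, show -(σ * ((g * P * ρ : ℕ) : ℤ)) + E = E - σ * (g * P * ρ : ℕ) by ring]
    exact hkey.symm.dvd

/-- **Residue rules are valuation rules.**  For `m ≥ 1` and `e ∈ ℤ`: the class `e + mℤ` contains no
`n` with `|n|` a sum of two squares IF AND ONLY IF some prime `q ≡ 3 (mod 4)` and odd `k` with
`q^(k+1) ∣ m` give `q^k ∥ e`. [Dirichlet + Fermat–Euler; elementary otherwise] -/
theorem residueRule_iff_certificate (m : ℕ) (hm : 0 < m) (e : ℤ) :
    (∀ n : ℤ, (m : ℤ) ∣ n - e → ¬ ∃ x y : ℕ, n.natAbs = x ^ 2 + y ^ 2) ↔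
    ∃ q k : ℕ, q.Prime ∧ q % 4 = 3 ∧ Odd k ∧ q ^ (k + 1) ∣ m ∧
      (q : ℤ) ^ k ∣ e ∧ ¬ (q : ℤ) ^ (k + 1) ∣ e := by
  constructor
  · intro hrule
    by_contra hno
    push Not at hno
    obtain ⟨n, hn, hS⟩ := exists_sq_add_sq_of_no_certificate m hm e
      fun q k hq hq3 hk hqm h1 => hno q k hq hq3 hk hqm h1
    exact hrule n hn hS
  · rintro ⟨q, k, hq, hq3, hk, hqm, h1, h2⟩
    exact residueRule_of_certificate hq hq3 hk hqm h1 h2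

/-- **Every residue rule for the Gaussian unital lift has `|D|² ≤ m`.**  Let `m ≥ 1` and let
`D ⊆ ℤ` be finite such that for all `d ≠ d'` in `D` no integer `n ≡ d − d' (mod m)` has `|n|` a sum of
two squares (so, in the lifted unital over `ℤ[i]`, real parts of heights taken from the digit
expansions of `D` in base `m` never differ by a norm, whatever the higher digits).  Then `|D|² ≤ m`:
residue rules never beat exponent `1/2`, in any base.  Sharp for `m = q²`, `q ≡ 3 (mod 4)`
(`residueRule_multiples`). [this file; Dirichlet + Fermat–Euler + the digit fingerprint of part 6] -/
theorem card_sq_le_of_residueRule (m : ℕ) (hm : 0 < m) (D : Finset ℤ)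
    (h : ∀ d ∈ D, ∀ d' ∈ D, d ≠ d' → ∀ n : ℤ, (m : ℤ) ∣ n - (d - d') →
      ¬ ∃ x y : ℕ, n.natAbs = x ^ 2 + y ^ 2) :
    D.card ^ 2 ≤ m :=
  card_sq_le_of_certificates m hm D fun d hd d' hd' hne => by
    obtain ⟨q, k, hq, -, hk, hqm, h1, h2⟩ :=
      (residueRule_iff_certificate m hm (d - d')).mp (h d hd d' hd' hne)
    exact ⟨q, k, hq, hk, hqm, h1, h2⟩

end Summit.MatrixMultiplication.MatrixMultiplication.Theorems.LevelOneGL2Designs.GaussianUnital
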